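import Summits.KontsevichZagierPeriods.KontsevichZagierPeriods.Theses.TerasomaMultiplication
import Summits.KontsevichZagierPeriods.KontsevichZagierPeriods.Theorems.CompleteModGammaSector.Negative.LoadBearing
import Literature.NumberTheory.Transcendental.KZProductIdeal
import Literature.NumberTheory.Transcendental.KZCalculusProofs
import Summits.KontsevichZagierPeriods.KontsevichZagierPeriods.Theorems.TerasomaMultiplicationCompleteModGammaSectorStubEulerInvolutionMove

/-!
# `CompleteModGammaSector` (stmt-KontsevichZagierPeriods-14233) — line `wolfart-collapses-to-huber-wustholz`

Crux proof SKELETON of the line lead (continuation seat c1), rebuilt against the three stubs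
REGISTERED on the item by the crux planner (skeleton sha 03774e22b3d7, 2026-08-16T08:46Z; card
`Cruxes/CompleteModGammaSector/Ideas/wolfart-collapses-to-huber-wustholz.md`). The crux (Conjecture 1
of Kontsevich–Zagier for the Γ-enlarged calculus; kernel form `ker eval ≤ sector`,
`CompleteModGammaSectorNegative.completeModGammaSector_iff_ker_le`, landed) is reduced to:

* `stub_eulerTransformedRep` + `stub_eulerInvolutionMove` (the lead's reshape of the planner's
  `stub_eulerTransformationMove` into its existence half and its move half, recombined below as the
  sorry-free `eulerTransformationMove`) — Euler's transformation
  `₂F₁(a,b;c;λ) = (1−λ)^{c−a−b} ₂F₁(c−a,c−b;c;λ)` in Euler-integral form as ONE rule-(2) move: the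
  involution `t ↦ (1−t)/(1−λt)` of `(0,1)` carries `[(0,1), α t^{b−1}(1−t)^{c−b−1}(1−λt)^{−a}]` onto
  `[(0,1), α' t^{c−b−1}(1−t)^{b−1}(1−λt)^{−(c−a)}]`, `α' = α(1−λ)^{c−a−b}` real algebraic
  (provable now: Mathlib's Jacobian change of variables + the tree's semialgebraic toolbox);
* `stub_eulerBetaTransfer` — the Wolfart sector, oriented `a + b ≤ c`, irreducible
  (`a, b, c−a, c−b ∉ ℤ`): an Euler integral at an algebraic argument whose value equals an algebraic
  multiple of a SINGLE Beta value is KZ-equivalent to that Beta representation (card: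
  Wüstholz's analytic subgroup theorem ⇒ isogeny onto a Fermat factor ⇒ one-dimensional
  correspondence transfer; leans on the unproved 1-period transfer engine
  `LowDimension.LowdimHuberWustholzTransfer` stmt-0117 — summit-implied, OPEN);
* `stub_residualOffHypergeometric` — the RESIDUAL (GPC-strength, crux-implied, honest remainder of
  the line): every value-zero combination lies in the Γ-sector enlarged by the Euler–Beta pair
  differences and their left multiples;

composed in `CompleteModGammaSector_of`: the residual puts `ker eval` inside
`sector ⊔ closure{Euler–Beta generators}`; each generator `[r] − [ρ]` is a relation by
`stub_eulerBetaTransfer` when `a + b ≤ c` and by `eulerTransformationMove` (stubs 1a + 1b) + `stub_eulerBetaTransfer`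
(applied to `(c−a, c−b, c)`) when `c < a + b` (`eulerBeta_mem_relations`); left multiples
`z · ([r] − [ρ])` are relations because `relations` is a left ideal
(`KZ.mul_mem_relations_left_holds`); hence `closure{…} ≤ relations ≤ sector` and the crux follows BY
NAME. No definition is introduced in this file (the generator set is written out in every
signature).

References: Kontsevich–Zagier 2001 §1.2; Andrews–Askey–Roy 1999 Thm 2.2.5 (Euler's transformation via
the Euler integral); Wolfart 1988; Huber–Wüstholz 2022 Ch. 6–8, Thm 13.3.
-/

noncomputable section

-- `Summit.KontsevichZagierPeriods.KontsevichZagierPeriods.…` is the tree's mandated layout (single-conjunct summit).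
set_option linter.dupNamespace false

namespace Summit.KontsevichZagierPeriods.KontsevichZagierPeriods.CompleteModGammaSectorLine

open MeasureTheory Set
open Literature.NumberTheory.Transcendental
open Literature.NumberTheory.Transcendental.KZ
open Summit.KontsevichZagierPeriods.KontsevichZagierPeriods.Theses.TerasomaMultiplication
  (CompleteModGammaSector)
open Summit.KontsevichZagierPeriods.CompleteModGammaSectorNegative
  (sector completeModGammaSector_iff_ker_le)

/-! ## Registered stubs -/

/-! ### LANDED stubs 1a + 1b (p96654, `Theorems/TerasomaMultiplicationCompleteModGammaSectorStubEulerInvolutionMove.lean`,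
imported above, same namespace, exact registered signatures): `stub_eulerTransformedRep` (existence
of the transformed Euler representation, algebraicity of `α(1−λ)^{c−a−b}`) and
`stub_eulerInvolutionMove` (the change-of-variables move `t ↦ (1−t)/(1−λt)`). -/

/-- STUB 2 (`EulerIntegralSingleBetaTransfer`, the Wolfart sector oriented `a + b ≤ c`; OPEN,
summit-implied): in the irreducible setting `a, b, c−a, c−b ∉ ℤ`, an Euler integral
`α ∫₀¹ t^{b−1}(1−t)^{c−b−1}(1−λt)^{−a} dt` at a real algebraic argument `λ ∈ (0,1)` whose value equals
`β B(x,y)` (`β` real algebraic, `x, y > 0` non-integers) is KZ-equivalent to the Beta representation.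
Card: value equality ⇒ (Wüstholz) isogeny onto a Fermat factor ⇒ 1-dimensional correspondence
transfer (leans on the unproved engine stmt-0117). [cite: Wolfart1988, Satz 1] -/
theorem stub_eulerBetaTransfer : ∀ (a b c x y : ℚ) (lam α β : ℝ), Int.fract a ≠ 0 → Int.fract b ≠ 0 → Int.fract (c - a) ≠ 0 → Int.fract (c - b) ≠ 0 → 0 < b → b < c → a + b ≤ c → 0 < x → 0 < y → Int.fract x ≠ 0 → Int.fract y ≠ 0 → 0 < lam → lam < 1 → IsAlgebraic ℚ lam → IsAlgebraic ℚ α → IsAlgebraic ℚ β → ∀ (r ρ : IntegralRep 1), r.domain = {t | t 0 ∈ Set.Ioo (0:ℝ) 1} → Set.EqOn r.integrand (fun t => α * (t 0) ^ ((b : ℝ) - 1) * (1 - t 0) ^ ((c : ℝ) - (b : ℝ) - 1) * (1 - lam * t 0) ^ (-(a : ℝ))) r.domain → ρ.domain = {t | t 0 ∈ Set.Ioo (0:ℝ) 1} → Set.EqOn ρ.integrand (fun t => β * (t 0) ^ ((x : ℝ) - 1) * (1 - t 0) ^ ((y : ℝ) - 1)) ρ.domain → r.value = ρ.value → Equivalent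 r ρ := by
  sorry

/-- STUB 3 (RESIDUAL `ResidualOffHypergeometric`; OPEN, GPC-strength, crux-implied): every
value-zero formal combination lies in the Γ-sector enlarged by the Euler–Beta pair differences and
their left multiples — Conjecture 1 modulo Γ and modulo the Wolfart sector.
[cite: KontsevichZagier2001, §1.2 Conjecture 1] -/
theorem stub_residualOffHypergeometric : eval.ker ≤ sector ⊔ AddSubgroup.closure {d : FormalRep | ∃ (a b c x y : ℚ) (lam α β : ℝ) (r ρ : IntegralRep 1), (Int.fract a ≠ 0 ∧ Int.fract b ≠ 0 ∧ Int.fract (c - a) ≠ 0 ∧ Int.fract (c - b) ≠ 0) ∧ (0 < b ∧ b < c) ∧ (0 < x ∧ 0 < y ∧ Int.fract x ≠ 0 ∧ Int.fract y ≠ 0) ∧ (0 < lam ∧ lam < 1 ∧ IsAlgebraic ℚ lam ∧ IsAlgebraic ℚ α ∧ IsAlgebraic ℚ β) ∧ r.domain = {t | t 0 ∈ Set.Ioo (0:ℝ) 1} ∧ Set.EqOn r.integrand (fun t => α * (t 0) ^ ((b : ℝ) - 1) * (1 - t 0) ^ ((c : ℝ) - (b : ℝ) - 1) * (1 - lam *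 t 0) ^ (-(a : ℝ))) r.domain ∧ ρ.domain = {t | t 0 ∈ Set.Ioo (0:ℝ) 1} ∧ Set.EqOn ρ.integrand (fun t => β * (t 0) ^ ((x : ℝ) - 1) * (1 - t 0) ^ ((y : ℝ) - 1)) ρ.domain ∧ r.value = ρ.value ∧ (d = of r - of ρ ∨ ∃ z : FormalRep, d = z * (of r - of ρ))} := by
  sorry

/-! ## Glue (sorry-free): every Euler–Beta generator is a relation -/

/-- **Euler's transformation as a move** (the planner's original stub `stub_eulerTransformationMove`,
now DERIVED from stubs 1a + 1b): the Euler integral `[(0,1), α t^{b−1}(1−t)^{c−b−1}(1−λt)^{−a}]` is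
KZ-equivalent to `[(0,1), α' t^{c−b−1}(1−t)^{b−1}(1−λt)^{−(c−a)}]` with `α' = α(1−λ)^{c−a−b}` real
algebraic. [cite: AndrewsAskeyRoy1999, Thm 2.2.5] -/
theorem eulerTransformationMove : ∀ (a b c : ℚ) (lam α : ℝ), 0 < b → b < c → 0 < lam → lam < 1 → IsAlgebraic ℚ lam → IsAlgebraic ℚ α → ∀ r : IntegralRep 1, r.domain = {t | t 0 ∈ Set.Ioo (0:ℝ) 1} → Set.EqOn r.integrand (fun t => α * (t 0) ^ ((b : ℝ) - 1) * (1 - t 0) ^ ((c : ℝ) - (b : ℝ) - 1) * (1 - lam * t 0) ^ (-(a : ℝ))) r.domain → ∃ (α' : ℝ) (r' : IntegralRep 1), IsAlgebraic ℚ α' ∧ r'.domain = {t | t 0 ∈ Set.Ioo (0:ℝ) 1} ∧ Set.EqOn r'.integrand (fun t => α' * (t 0) ^ ((c : ℝ) - (b : ℝ) - 1) * (1 - t 0) ^ ((b : ℝ) - 1) * (1 - lam * t 0) ^ (-((c : ℝ) - (a : ℝ)))) r'.domain ∧ Equivalent r r' := by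
  intro a b c lam α hb0 hbc hl0 hl1 hlam hα r hrd hri
  obtain ⟨hα', r', hr'd, hr'i⟩ := stub_eulerTransformedRep a b c lam α hb0 hbc hl0 hl1 hlam hα
  exact ⟨_, r', hα', hr'd, fun t _ => by rw [hr'i],
    stub_eulerInvolutionMove a b c lam α hb0 hbc hl0 hl1 hlam hα r r' hrd hri hr'd fun t _ => by rw [hr'i]⟩

/-- **Both orientations of the Wolfart sector.** An irreducible Euler–Beta pair of equal value is a
KZ-equivalence: for `a + b ≤ c` this is `stub_eulerBetaTransfer`; for `c < a + b` apply Euler's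
transformation move first (`eulerTransformationMove`), which lands in the parameters
`(c−a, c−b, c)` with `(c−a) + (c−b) ≤ c`, the same irreducibility data and the same value
(`KZ.Equivalent.value_eq_holds`), and compose. [cite: AndrewsAskeyRoy1999, Thm 2.2.5] -/
theorem eulerBeta_equivalent (a b c x y : ℚ) (lam α β : ℝ) (r ρ : IntegralRep 1)
    (ha : Int.fract a ≠ 0) (hb : Int.fract b ≠ 0) (hca : Int.fract (c - a) ≠ 0)
    (hcb : Int.fract (c - b) ≠ 0) (hb0 : 0 < b) (hbc : b < c) (hx : 0 < x) (hy : 0 < y)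
    (hxf : Int.fract x ≠ 0) (hyf : Int.fract y ≠ 0) (hl0 : 0 < lam) (hl1 : lam < 1)
    (hlam : IsAlgebraic ℚ lam) (hα : IsAlgebraic ℚ α) (hβ : IsAlgebraic ℚ β)
    (hrd : r.domain = {t | t 0 ∈ Set.Ioo (0:ℝ) 1})
    (hri : Set.EqOn r.integrand (fun t => α * (t 0) ^ ((b : ℝ) - 1) * (1 - t 0) ^ ((c : ℝ) - (b : ℝ) - 1) *
      (1 - lam * t 0) ^ (-(a : ℝ))) r.domain)
    (hρd : ρ.domain = {t | t 0 ∈ Set.Ioo (0:ℝ) 1})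
    (hρi : Set.EqOn ρ.integrand (fun t => β * (t 0) ^ ((x : ℝ) - 1) * (1 - t 0) ^ ((y : ℝ) - 1)) ρ.domain)
    (hv : r.value = ρ.value) : Equivalent r ρ := by
  rcases le_or_gt (a + b) c with h | h
  · exact stub_eulerBetaTransfer a b c x y lam α β ha hb hca hcb hb0 hbc h hx hy hxf hyf hl0 hl1 hlam
      hα hβ r ρ hrd hri hρd hρi hv
  · obtain ⟨α', r', hα', hr'd, hr'i, hrr'⟩ :=
      eulerTransformationMove a b c lam α hb0 hbc hl0 hl1 hlam hα r hrd hri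
    have hv' : r'.value = ρ.value := (Equivalent.value_eq_holds hrr').symm.trans hv
    have hca' : Int.fract (c - (c - a)) ≠ 0 := by simpa using ha
    have hcb' : Int.fract (c - (c - b)) ≠ 0 := by simpa using hb
    have hr'i' : Set.EqOn r'.integrand (fun t => α' * (t 0) ^ (((c - b : ℚ) : ℝ) - 1) *
        (1 - t 0) ^ ((c : ℝ) - ((c - b : ℚ) : ℝ) - 1) * (1 - lam * t 0) ^ (-((c - a : ℚ) : ℝ)))
        r'.domain := by
      intro t ht
      rw [hr'i ht]
      have e1 : ((c : ℝ) - ((c - b : ℚ) : ℝ) - 1) = (b : ℝ) - 1 := by push_cast; ring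
      have e2 : (((c - b : ℚ) : ℝ) - 1) = (c : ℝ) - (b : ℝ) - 1 := by push_cast; ring
      have e3 : (-((c - a : ℚ) : ℝ)) = -((c : ℝ) - (a : ℝ)) := by push_cast; ring
      simp only [e1, e2, e3]
    have h2 : Equivalent r' ρ :=
      stub_eulerBetaTransfer (c - a) (c - b) c x y lam α' β hca hcb hca' hcb' (by linarith)
        (by linarith) (by linarith) hx hy hxf hyf hl0 hl1 hlam hα' hβ r' ρ hr'd hr'i' hρd hρi hv'
    exact hrr'.trans h2

/-- The Euler–Beta generators (pair differences and their left multiples) are relations: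
`eulerBeta_equivalent` and `relations` is a left ideal (`KZ.mul_mem_relations_left_holds`).
[cite: KontsevichZagier2001, §1.2] -/
theorem closure_eulerBeta_le_relations :
    AddSubgroup.closure {d : FormalRep | ∃ (a b c x y : ℚ) (lam α β : ℝ) (r ρ : IntegralRep 1),
      (Int.fract a ≠ 0 ∧ Int.fract b ≠ 0 ∧ Int.fract (c - a) ≠ 0 ∧ Int.fract (c - b) ≠ 0) ∧
      (0 < b ∧ b < c) ∧ (0 < x ∧ 0 < y ∧ Int.fract x ≠ 0 ∧ Int.fract y ≠ 0) ∧
      (0 < lam ∧ lam < 1 ∧ IsAlgebraic ℚ lam ∧ IsAlgebraic ℚ α ∧ IsAlgebraic ℚ β) ∧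
      r.domain = {t | t 0 ∈ Set.Ioo (0:ℝ) 1} ∧
      Set.EqOn r.integrand (fun t => α * (t 0) ^ ((b : ℝ) - 1) * (1 - t 0) ^ ((c : ℝ) - (b : ℝ) - 1) *
        (1 - lam * t 0) ^ (-(a : ℝ))) r.domain ∧
      ρ.domain = {t | t 0 ∈ Set.Ioo (0:ℝ) 1} ∧
      Set.EqOn ρ.integrand (fun t => β * (t 0) ^ ((x : ℝ) - 1) * (1 - t 0) ^ ((y : ℝ) - 1)) ρ.domain ∧
      r.value = ρ.value ∧ (d = of r - of ρ ∨ ∃ z : FormalRep, d = z * (of r - of ρ))} ≤ relations := by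
  rw [AddSubgroup.closure_le]
  rintro d ⟨a, b, c, x, y, lam, α, β, r, ρ, ⟨ha, hb, hca, hcb⟩, ⟨hb0, hbc⟩, ⟨hx, hy, hxf, hyf⟩,
    ⟨hl0, hl1, hlam, hα, hβ⟩, hrd, hri, hρd, hρi, hv, hd⟩
  have he : of r - of ρ ∈ relations :=
    eulerBeta_equivalent a b c x y lam α β r ρ ha hb hca hcb hb0 hbc hx hy hxf hyf hl0 hl1 hlam hα hβ
      hrd hri hρd hρi hv
  rcases hd with rfl | ⟨z, rfl⟩
  · exact he
  · exact mul_mem_relations_left_holds _ z he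

/-! ## Composition -/

/-- **The crux from the registered stubs**: kernel form (`completeModGammaSector_iff_ker_le`), the
residual puts `ker eval` in `sector ⊔ closure{Euler–Beta generators}`, and the generators are
relations (`closure_eulerBeta_le_relations`), hence in `sector`.
[cite: KontsevichZagier2001, §1.2 Conjecture 1] -/
theorem CompleteModGammaSector_of : CompleteModGammaSector := by
  refine completeModGammaSector_iff_ker_le.mpr (le_trans stub_residualOffHypergeometric (sup_le le_rfl ?_))
  exact le_trans closure_eulerBeta_le_relations le_sup_left

/-! ## Sorry-free bookkeeping: the residual is crux-implied (no kill short of `¬` summit) -/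

/-- The residual is crux-implied (`le_sup_left`). [folklore] -/
theorem residualOffHypergeometric_of_crux (h : CompleteModGammaSector) (S : AddSubgroup FormalRep) :
    eval.ker ≤ sector ⊔ S :=
  le_trans (completeModGammaSector_iff_ker_le.mp h) le_sup_left

end Summit.KontsevichZagierPeriods.KontsevichZagierPeriods.CompleteModGammaSectorLine
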